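/-
Copyright: statement-level skeleton of a published paper (lit-balaban cell, Phase-2 proof seat p10, gen 2). No proof claims
beyond what the kernel checks below.
-/
import Mathlib
import Literature.MathematicalPhysics.QuantumFieldTheory.BalabanImbrieJaffe1984to88.BIJ85Sect4Statements

/-!
# `BalabanImbrieJaffe1984to88.BIJ85CurlComplement719` — T. Bałaban, J. Imbrie, A. Jaffe, *Renormalization of the Higgs
model: minimizers, propagators and the stability of mean field theory*, Commun. Math. Phys. **97** (1985) 299–329
[BalabanImbrieJaffe1985]: Sect. 7.1 pp. 322–325 — the momentum-p two-forms 𝒦(p), the inner product (7.1.19b) and the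
orthogonal complement of the curls (7.1.19a), the bracket [δ_{μλ} − ∂_μ∂̄_λ/Δ] of (7.1.14) as an orthogonal projection
for generic symbol data, "the ∂ terms vanish" on (∂𝒦)^⊥ (the mechanism of (7.1.29)), and (7.1.31)

statement-level skeleton of published theorems with citation tags; proofs where landed; nothing here is a claim about
the Yang–Mills mass gap

PDF held: `paper:balaban1985-cmp97-bij-higgs-minimizers` (journal page = PDF page + 298).  Renders read as images: PDF pp. 24–27
(journal 322–325), poppler renders in the seat folder (`renders/c2-p024…p027.png`).

CITATION HEADER (lean-in-tree rule).  Part of the lit-balaban TYPED SKELETON (HOME `run/shared/lean/pub/lit-balaban/`); WHAT IS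
REPRODUCED: the (7.1.19) part of SKELETON row **C1.Eq7.1.13-7.1.19** and the (7.1.29)-mechanism / (7.1.31) part of
**C1.Eq7.1.28-7.1.31** of `HOME/lit-balaban-r15/ROWS-C1.md` (fold owner r15, referee ref-5), at one momentum p and for GENERIC
data: two-forms are `f : Fin d → Fin d → ℂ` (antisymmetric, `IsTwoForm`), one-forms `B : Fin d → ℂ`, eigenvalue data
v = (v_μ(p))_μ and symbol data ∂ = (∂_μ)_μ are vectors `Fin d → ℂ`.  The concrete symbols (7.1.4)–(7.1.16) — ∂(p), v_μ(p), u(p),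
the bracket `projSym`, τ₁ `tau1Term`/`tau1Sym`, the curl components `curlOne`, "τ₁ vanishes on curls" (7.1.17)–(7.1.18) — are
r15's `BIJ85MomentumSymbols71` (rows C1.Eq7.1.2-7.1.12, C1.Eq7.1.13-7.1.19 of record); nothing here depends on them (the sibling
`BIJ85Tau0Positivity729` instantiates: `curlOne p′ B = curlP (dOne p′) B`, `projSym η q = projK (dSym η q)`).
* **(7.1.19b)** `formV` (f, g) = Σ f̄_{μν}|v_μv_ν|^{−2}g_{μν}, `formV_self`; the remark *"c₁⟨f,f⟩ ≤ (f,f) ≤ c₂⟨f,f⟩"* PROVED with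
  c₁ = (2/π)⁴, c₂ = (π/2)⁴ for eigenvalues obeying (7.1.20) (`formV_self_bounds`); **(7.1.19a)** curls ∂ℋ(p) (`curlP`) and
  membership in (∂ℋ(p))^⊥ (`PerpCurl`).
* **(7.1.14)**, the bracket for generic symbol data ∂ ∈ ℂ^d, as a matrix: `projK ∂` = 1 − Δ⁻¹·∂∂̄ᵀ, Δ = Σ|∂_ρ|² — p. 323
  *"the expressions inside brackets [ ] are projection operators"* PROVED with no hypothesis on Δ (`projK_conjTranspose`,
  `projK_mul_projK`; at ∂ = 0 the bracket is the identity) — the generic form of r15's `BIJ85MomentumSymbols71.projSym`.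
* **(7.1.29)**, mechanism (p. 325 *"because f^⊥ is defined with respect to the inner product (7.1.19b), τ₀ simplifies on f^⊥.
  In particular the ∂ terms vanish"*): for f ∈ (∂𝒦)^⊥ with curls ∂^{(1)}_μ = v_μ∂_μ ((7.1.7)), g = f/(vv) has vanishing
  ∂̄-divergences and the bracket fixes it on both indices (`div_eq_zero_of_perp`, `projK_mul_of`, `of_mul_projK_transpose`).
* **(7.1.31)** ⟨∂B,τ₂∂B⟩ = ⟨∂B,σ_k∂B⟩ = ⟨B,Δ_kB⟩ (`eq7131`, `eq7131_deltaForm` = the definition (4.3.1)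
  `BIJ85Sect4Statements.GaugeRG.DeltaForm`).
* v1.1 (append-only): **(7.1.19a)** EXISTENCE of the decomposition f = ∂B + f^⊥, f^⊥ ∈ (∂ℋ(p))^⊥, PROVED (`exists_decomp719`,
  `exists_decomp719_twoForm`; `curlLin`, `scaleLin`, `formV_eq_inner`), and its UNIQUENESS when no v_μ(p) vanishes
  (`eq_zero_of_formV_self_eq_zero`, `decomp719_unique`: 𝒦(p) = ∂ℋ(p) ⊕ (∂ℋ(p))^⊥ is a direct sum).
NOT here: the l-terms and (7.1.28)–(7.1.30) (`BIJ85Tau0Positivity729`).  Unit `lit-balaban-p10` (gen 2), HOME as above.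
-/

namespace Literature.MathematicalPhysics.QuantumFieldTheory.BalabanImbrieJaffe1984to88.BIJ85CurlComplement719

open scoped BigOperators Real ComplexConjugate Matrix
open Complex Finset Matrix

noncomputable section

variable {d : ℕ}

/-! ## Two-forms at momentum p, the inner product (7.1.19b), curls and their orthogonal complement (7.1.19a) -/

/-- p. 321: *"functions f_{μν} on plaquettes given as antisymmetric functions on coordinate axes μ, ν"* — the momentum-p
two-forms 𝒦(p). [cite: BalabanImbrieJaffe1985, (7.1.19) p.323] -/
def IsTwoForm (f : Fin d → Fin d → ℂ) : Prop :=
  ∀ μ ν, f ν μ = -f μ ν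

/-- ‖f‖² = ⟨f, f⟩ = Σ_{μν} |f_{μν}|², the norm of (7.1.25)–(7.1.27) ("ε‖f^⊥‖²"). [cite: BalabanImbrieJaffe1985, (7.1.19) p.323] -/
def normSq (f : Fin d → Fin d → ℂ) : ℝ :=
  ∑ μ, ∑ ν, ‖f μ ν‖ ^ 2

/-- **(7.1.19b)** p. 323 [PDF 25], verbatim: *"Here we now introduce the scalar product, (f, g) = Σ_{μ,ν} \overline{f_{μν}(p)}
|v_μ(p)v_ν(p)|^{−2} g_{μν}(p) = ⟨f, |V|^{−2} ⊗ |V|^{−2} g⟩, (7.1.19b)"* — at one momentum, given the eigenvalues v = (v_μ(p))_μ.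
[cite: BalabanImbrieJaffe1985, (7.1.19b) p.323] -/
def formV (v : Fin d → ℂ) (f g : Fin d → Fin d → ℂ) : ℂ :=
  ∑ μ, ∑ ν, conj (f μ ν) * (((‖v μ * v ν‖ ^ 2)⁻¹ : ℝ) : ℂ) * g μ ν

/-- Curls at momentum p: (∂B)_{μν} = ∂_μB_ν − ∂_νB_μ for a momentum-p one-form B ∈ ℋ(p), with the unit-lattice symbol
∂ = ∂^{(1)}(p) of (7.1.5) (p. 323: *"Let ℋ(p) denote the space of momentum p lattice one-forms B"*).
[cite: BalabanImbrieJaffe1985, (7.1.19) p.323] -/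
def curlP (d1 : Fin d → ℂ) (B : Fin d → ℂ) : Fin d → Fin d → ℂ :=
  fun μ ν => d1 μ * B ν - d1 ν * B μ

/-- **(7.1.19a)** p. 323 [PDF 25], verbatim: *"Write the two-forms 𝒦(p) as a sum of curls and an orthogonal complement, 𝒦(p) =
∂ℋ(p) + (∂ℋ(p))^⊥. (7.1.19a) … and the decomposition (7.1.19) is with respect to this inner product."* — membership of f in
(∂ℋ(p))^⊥ for the product (7.1.19b): (∂B, f) = 0 for every one-form B. [cite: BalabanImbrieJaffe1985, (7.1.19a) p.323] -/
def PerpCurl (d1 v : Fin d → ℂ) (f : Fin d → Fin d → ℂ) : Prop :=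
  ∀ B : Fin d → ℂ, formV v (curlP d1 B) f = 0

/-- (f, f) = Σ_{μν} |f_{μν}|²/|v_μv_ν|² (real). [cite: BalabanImbrieJaffe1985, (7.1.19b) p.323] -/
theorem formV_self (v : Fin d → ℂ) (f : Fin d → Fin d → ℂ) :
    formV v f f = ((∑ μ, ∑ ν, ‖f μ ν‖ ^ 2 / ‖v μ * v ν‖ ^ 2 : ℝ) : ℂ) := by
  unfold formV
  push_cast
  refine Finset.sum_congr rfl fun μ _ => Finset.sum_congr rfl fun ν _ => ?_
  rw [mul_right_comm, Complex.conj_mul', div_eq_mul_inv]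

/-- p. 323 [PDF 25], verbatim: *"Remark that there are strictly positive constants c₁, c₂ such that c₁⟨f,f⟩ ≤ (f,f) ≤ c₂⟨f,f⟩,
so the corresponding norms are equivalent. In fact |v_μ(p)| = … it follows that for |p_i| ≤ π, 2/π ≤ |v_μ(p)| ≤ π/2. (7.1.20)"*
— PROVED with the explicit c₁ = (2/π)⁴, c₂ = (π/2)⁴, for any eigenvalues obeying (7.1.20).
[cite: BalabanImbrieJaffe1985, (7.1.20) p.323] -/
theorem formV_self_bounds {v : Fin d → ℂ} (hv : ∀ μ, 2 / π ≤ ‖v μ‖ ∧ ‖v μ‖ ≤ π / 2) (f : Fin d → Fin d → ℂ) :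
    (2 / π) ^ 4 * normSq f ≤ (formV v f f).re ∧ (formV v f f).re ≤ (π / 2) ^ 4 * normSq f := by
  rw [formV_self, Complex.ofReal_re, normSq, Finset.mul_sum, Finset.mul_sum]
  have hπ : 0 < π := Real.pi_pos
  have h2π : 0 < 2 / π := by positivity
  have key : ∀ μ ν, (2 / π) ^ 4 * ‖f μ ν‖ ^ 2 ≤ ‖f μ ν‖ ^ 2 / ‖v μ * v ν‖ ^ 2 ∧
      ‖f μ ν‖ ^ 2 / ‖v μ * v ν‖ ^ 2 ≤ (π / 2) ^ 4 * ‖f μ ν‖ ^ 2 := by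
    intro μ ν
    have hμ := hv μ
    have hν := hv ν
    have hpos : 0 < ‖v μ * v ν‖ := by rw [norm_mul]; exact mul_pos (h2π.trans_le hμ.1) (h2π.trans_le hν.1)
    rw [norm_mul] at hpos ⊢
    have hup : (‖v μ‖ * ‖v ν‖) ^ 2 ≤ ((π / 2) * (π / 2)) ^ 2 :=
      pow_le_pow_left₀ hpos.le (mul_le_mul hμ.2 hν.2 (norm_nonneg _) (by positivity)) 2
    have hlo : ((2 / π) * (2 / π)) ^ 2 ≤ (‖v μ‖ * ‖v ν‖) ^ 2 :=
      pow_le_pow_left₀ (by positivity) (mul_le_mul hμ.1 hν.1 h2π.le (norm_nonneg _)) 2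
    have hf : 0 ≤ ‖f μ ν‖ ^ 2 := sq_nonneg _
    constructor
    · rw [le_div_iff₀ (by positivity)]
      calc (2 / π) ^ 4 * ‖f μ ν‖ ^ 2 * (‖v μ‖ * ‖v ν‖) ^ 2
          ≤ (2 / π) ^ 4 * ‖f μ ν‖ ^ 2 * ((π / 2) * (π / 2)) ^ 2 :=
            mul_le_mul_of_nonneg_left hup (by positivity)
        _ = ‖f μ ν‖ ^ 2 := by field_simp
    · rw [div_le_iff₀ (by positivity)]
      calc ‖f μ ν‖ ^ 2 = (π / 2) ^ 4 * ‖f μ ν‖ ^ 2 * ((2 / π) * (2 / π)) ^ 2 := by field_simp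
        _ ≤ (π / 2) ^ 4 * ‖f μ ν‖ ^ 2 * (‖v μ‖ * ‖v ν‖) ^ 2 :=
            mul_le_mul_of_nonneg_left hlo (by positivity)
  constructor
  · exact Finset.sum_le_sum fun μ _ => by
      rw [Finset.mul_sum]; exact Finset.sum_le_sum fun ν _ => (key μ ν).1
  · exact Finset.sum_le_sum fun μ _ => by
      rw [Finset.mul_sum]; exact Finset.sum_le_sum fun ν _ => (key μ ν).2

/-- The bracket of (7.1.14): [δ_{μλ} − ∂_μ∂̄_λ/Δ], Δ = Σ_ρ|∂_ρ|² (Δ(p) of (7.1.6)), for a vector ∂ = (∂_μ)_μ of symbols — p. 323: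
*"In both τ₁ and τ₂ the expressions inside brackets [ ] are projection operators."* [cite: BalabanImbrieJaffe1985, (7.1.14) p.322] -/
def projK (e : Fin d → ℂ) : Matrix (Fin d) (Fin d) ℂ :=
  1 - (((∑ ρ, ‖e ρ‖ ^ 2)⁻¹ : ℝ) : ℂ) • Matrix.vecMulVec e (star e)

/-- The bracket entrywise: δ_{μλ} − ∂_μ∂̄_λ/Δ. [cite: BalabanImbrieJaffe1985, (7.1.14) p.322] -/
theorem projK_apply (e : Fin d → ℂ) (μ l : Fin d) :
    projK e μ l = (if μ = l then 1 else 0) - e μ * conj (e l) / (((∑ ρ, ‖e ρ‖ ^ 2 : ℝ)) : ℂ) := by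
  simp only [projK, Matrix.sub_apply, Matrix.one_apply, Matrix.smul_apply, Matrix.vecMulVec_apply, Pi.star_apply,
    Complex.star_def, smul_eq_mul, Complex.ofReal_inv]
  ring

/-- kernel: (Σ_ρ|∂_ρ|²) as the self-pairing star ∂ ⬝ ∂. [folklore] -/
private theorem star_dotProduct_self_eq (e : Fin d → ℂ) :
    star e ⬝ᵥ e = ((∑ ρ, ‖e ρ‖ ^ 2 : ℝ) : ℂ) := by
  simp only [dotProduct, Pi.star_apply, Complex.star_def, Complex.conj_mul']
  push_cast
  rfl

/-- p. 323, *"the expressions inside brackets [ ] are projection operators"*: the bracket is self-adjoint …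
[cite: BalabanImbrieJaffe1985, (7.1.14) p.322] -/
theorem projK_conjTranspose (e : Fin d → ℂ) : (projK e)ᴴ = projK e := by
  unfold projK
  rw [Matrix.conjTranspose_sub, Matrix.conjTranspose_one, Matrix.conjTranspose_smul, Matrix.conjTranspose_vecMulVec,
    star_star]
  congr 2
  rw [Complex.star_def, Complex.conj_ofReal]

/-- … and idempotent (when ∂ = 0 the bracket is the identity). [cite: BalabanImbrieJaffe1985, (7.1.14) p.322] -/
theorem projK_mul_projK (e : Fin d → ℂ) : projK e * projK e = projK e := by
  set Δ : ℝ := ∑ ρ, ‖e ρ‖ ^ 2 with hΔ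
  by_cases h0 : Δ = 0
  · have he : e = 0 := by
      funext ρ
      have : ‖e ρ‖ ^ 2 = 0 := by
        have hle : ‖e ρ‖ ^ 2 ≤ Δ := by
          rw [hΔ]; exact Finset.single_le_sum (fun i _ => sq_nonneg ‖e i‖) (Finset.mem_univ ρ)
        exact le_antisymm (by linarith) (sq_nonneg _)
      exact norm_eq_zero.mp (pow_eq_zero_iff (two_ne_zero)|>.mp this)
    simp [projK, he]
  · have hΔc : (Δ : ℂ) ≠ 0 := Complex.ofReal_ne_zero.mpr h0
    have key : Matrix.vecMulVec e (star e) * Matrix.vecMulVec e (star e) = (Δ : ℂ) • Matrix.vecMulVec e (star e) := by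
      rw [Matrix.vecMulVec_mul_vecMulVec, star_dotProduct_self_eq, ← hΔ, Matrix.vecMulVec_smul]
    unfold projK
    rw [← hΔ]
    set V : Matrix (Fin d) (Fin d) ℂ := Matrix.vecMulVec e (star e)
    set c : ℂ := ((Δ⁻¹ : ℝ) : ℂ) with hc
    have hcΔ : c * c * (Δ : ℂ) = c := by rw [hc]; push_cast; field_simp
    calc (1 - c • V) * (1 - c • V) = 1 - c • V - c • V + c • (c • (V * V)) := by
          simp only [sub_mul, mul_sub, Matrix.one_mul, Matrix.mul_one, Matrix.smul_mul, Matrix.mul_smul]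
          abel
      _ = 1 - c • V := by rw [key, smul_smul, smul_smul, hcΔ]; abel

/-- g_{λκ} = f_{λκ}/(v_λv_κ) (the substitution behind (7.1.29)). [cite: BalabanImbrieJaffe1985, (7.1.29) p.325] -/
def gOf (v : Fin d → ℂ) (f : Fin d → Fin d → ℂ) : Fin d → Fin d → ℂ :=
  fun l κ => f l κ / (v l * v κ)

/-- kernel: the cast weight of (7.1.19b) as inverses of z̄z. [folklore] -/
private theorem cast_inv_norm_mul_sq (a b : ℂ) :
    (((‖a * b‖ ^ 2)⁻¹ : ℝ) : ℂ) = (conj a * a)⁻¹ * (conj b * b)⁻¹ := by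
  rw [Complex.conj_mul', Complex.conj_mul', norm_mul]
  push_cast
  ring

/-- The pairing (7.1.19b) of a curl with a two-form: (∂B, f) = 2 Σ_ν B̄_ν Σ_μ ∂̄_μ |v_μv_ν|^{−2} f_{μν}.
[cite: BalabanImbrieJaffe1985, (7.1.19b) p.323] -/
theorem formV_curl (d1 v : Fin d → ℂ) (B : Fin d → ℂ) {f : Fin d → Fin d → ℂ} (hf : IsTwoForm f) :
    formV v (curlP d1 B) f =
      2 * ∑ ν, conj (B ν) * ∑ μ, conj (d1 μ) * (((‖v μ * v ν‖ ^ 2)⁻¹ : ℝ) : ℂ) * f μ ν := by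
  unfold formV curlP
  have hW : ∀ μ ν, (((‖v ν * v μ‖ ^ 2)⁻¹ : ℝ) : ℂ) = (((‖v μ * v ν‖ ^ 2)⁻¹ : ℝ) : ℂ) := by
    intro μ ν; rw [mul_comm]
  set S : ℂ := ∑ ν, conj (B ν) * ∑ μ, conj (d1 μ) * (((‖v μ * v ν‖ ^ 2)⁻¹ : ℝ) : ℂ) * f μ ν with hS
  have h1 : ∑ μ, ∑ ν, conj (d1 μ * B ν - d1 ν * B μ) * (((‖v μ * v ν‖ ^ 2)⁻¹ : ℝ) : ℂ) * f μ ν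
      = (∑ μ, ∑ ν, conj (B ν) * (conj (d1 μ) * (((‖v μ * v ν‖ ^ 2)⁻¹ : ℝ) : ℂ) * f μ ν))
        - ∑ μ, ∑ ν, conj (B μ) * (conj (d1 ν) * (((‖v μ * v ν‖ ^ 2)⁻¹ : ℝ) : ℂ) * f μ ν) := by
    rw [← Finset.sum_sub_distrib]
    refine Finset.sum_congr rfl fun μ _ => ?_
    rw [← Finset.sum_sub_distrib]
    refine Finset.sum_congr rfl fun ν _ => ?_
    simp only [map_sub, map_mul]
    ring
  have h2 : ∑ μ, ∑ ν, conj (B ν) * (conj (d1 μ) * (((‖v μ * v ν‖ ^ 2)⁻¹ : ℝ) : ℂ) * f μ ν) = S := by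
    rw [hS, Finset.sum_comm]
    simp only [Finset.mul_sum]
  have h3 : ∑ μ, ∑ ν, conj (B μ) * (conj (d1 ν) * (((‖v μ * v ν‖ ^ 2)⁻¹ : ℝ) : ℂ) * f μ ν) = -S := by
    rw [hS, ← Finset.sum_neg_distrib]
    refine Finset.sum_congr rfl fun μ _ => ?_
    rw [Finset.mul_sum, ← Finset.sum_neg_distrib]
    refine Finset.sum_congr rfl fun ν _ => ?_
    rw [hf μ ν, hW μ ν]
    ring
  rw [h1, h2, h3]
  ring

/-- p. 325, *"the ∂ terms vanish"*: orthogonality to all curls forces the divergence Σ_μ ∂̄_μ g_{μρ} of g = f/(vv) to vanish,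
when the curls are taken with ∂^{(1)}_μ = v_μ∂_μ ((7.1.7)) and no v_μ vanishes — PROVED.
[cite: BalabanImbrieJaffe1985, (7.1.29) p.325] -/
theorem div_eq_zero_of_perp {v e : Fin d → ℂ} {f : Fin d → Fin d → ℂ} (hf : IsTwoForm f) (hv : ∀ μ, v μ ≠ 0)
    (hperp : PerpCurl (fun μ => v μ * e μ) v f) (ρ : Fin d) :
    ∑ μ, conj (e μ) * gOf v f μ ρ = 0 := by
  have h := hperp (Pi.single ρ 1)
  rw [formV_curl _ _ _ hf] at h
  have hsingle : ∀ ν, conj ((Pi.single ρ (1 : ℂ) : Fin d → ℂ) ν) = if ν = ρ then 1 else 0 := by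
    intro ν
    by_cases hν : ν = ρ
    · subst hν; simp
    · simp [hν]
  simp_rw [hsingle, ite_mul, one_mul, zero_mul, Finset.sum_ite_eq', Finset.mem_univ, if_true] at h
  -- each summand: conj(v_μ∂_μ) |v_μv_ρ|^{−2} f_{μρ} = ∂̄_μ g_{μρ} / v̄_ρ
  have hterm : ∀ μ, conj (v μ * e μ) * (((‖v μ * v ρ‖ ^ 2)⁻¹ : ℝ) : ℂ) * f μ ρ
      = (conj (v ρ))⁻¹ * (conj (e μ) * gOf v f μ ρ) := by
    intro μ
    rw [cast_inv_norm_mul_sq, map_mul, gOf]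
    have h1 : conj (v μ) ≠ 0 := (map_ne_zero _).mpr (hv μ)
    have h2 : conj (v ρ) ≠ 0 := (map_ne_zero _).mpr (hv ρ)
    have h3 := hv μ
    have h4 := hv ρ
    field_simp
  simp_rw [hterm, ← Finset.mul_sum] at h
  have hc : (2 : ℂ) * (conj (v ρ))⁻¹ ≠ 0 := mul_ne_zero two_ne_zero (inv_ne_zero ((map_ne_zero _).mpr (hv ρ)))
  rw [← mul_assoc] at h
  exact (mul_eq_zero.mp h).resolve_left hc

/-- p. 325, *"the ∂ terms vanish"*: the bracket of (7.1.14) fixes g on the left when the column divergence Σ_μ ∂̄_μ g_{μρ}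
vanishes … [cite: BalabanImbrieJaffe1985, (7.1.29) p.325] -/
theorem projK_mul_of {e : Fin d → ℂ} {g : Fin d → Fin d → ℂ} (hdiv : ∀ ρ, ∑ μ, conj (e μ) * g μ ρ = 0) :
    projK e * Matrix.of g = Matrix.of g := by
  have hv : star e ᵥ* Matrix.of g = 0 := by
    funext ρ
    simp only [Matrix.vecMul, dotProduct, Pi.star_apply, Complex.star_def, Matrix.of_apply, Pi.zero_apply]
    exact hdiv ρ
  unfold projK
  rw [sub_mul, Matrix.one_mul, Matrix.smul_mul, Matrix.vecMulVec_mul, hv, Matrix.vecMulVec_zero, smul_zero, sub_zero]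

/-- … and on the right (the transposed bracket) when the row divergence Σ_κ g_{μκ}∂̄_κ vanishes.
[cite: BalabanImbrieJaffe1985, (7.1.29) p.325] -/
theorem of_mul_projK_transpose {e : Fin d → ℂ} {g : Fin d → Fin d → ℂ}
    (hdiv' : ∀ μ, ∑ κ, g μ κ * conj (e κ) = 0) : Matrix.of g * (projK e)ᵀ = Matrix.of g := by
  have hv : Matrix.of g *ᵥ star e = 0 := by
    funext μ
    simp only [Matrix.mulVec, dotProduct, Pi.star_apply, Complex.star_def, Matrix.of_apply, Pi.zero_apply]
    exact hdiv' μ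
  unfold projK
  rw [Matrix.transpose_sub, Matrix.transpose_one, Matrix.transpose_smul, Matrix.transpose_vecMulVec, mul_sub,
    Matrix.mul_one, Matrix.mul_smul, Matrix.mul_vecMulVec, hv, Matrix.zero_vecMulVec, smul_zero, sub_zero]

/-- **(7.1.31)** p. 325 [PDF 27], verbatim: *"Next we consider the bound on τ₂↾∂𝒦. But since τ₁∂ = 0, ⟨∂B, τ₂∂B⟩ = ⟨∂B, σ_k∂B⟩ =
⟨B, Δ_kB⟩, (7.1.31) using the definition (4.3.1) of Δ_k."* — the first equality PROVED from σ_k = τ₁ + τ₂ (7.1.13) as forms and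
⟨∂B, τ₁∂B⟩ = 0. [cite: BalabanImbrieJaffe1985, (7.1.31) p.325] -/
theorem eq7131 {S T1 T2 : ℝ} (h13 : S = T1 + T2) (h18 : T1 = 0) : T2 = S := by
  rw [h13, h18, zero_add]

/-- **(7.1.31)**, second equality: ⟨∂B, σ_k∂B⟩ = ⟨B, Δ_kB⟩ IS the definition (4.3.1) of Δ_k
(`BIJ85Sect4Statements.GaugeRG.DeltaForm`). [cite: BalabanImbrieJaffe1985, (7.1.31) p.325] -/
theorem eq7131_deltaForm (S : BIJ85Sect4Statements.GaugeRG) (B : S.FieldU) :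
    S.sigma (S.curl B) (S.curl B) = S.DeltaForm B B := rfl

/-! ## v1.1 (append-only): (7.1.19a) — EXISTENCE (and uniqueness) of the decomposition 𝒦(p) = ∂ℋ(p) + (∂ℋ(p))^⊥ (p. 323)

Proof: finite-dimensional orthogonal decomposition in `EuclideanSpace ℂ (Fin d × Fin d)` after the rescaling
f_{μν} ↦ f_{μν}/|v_μv_ν|, which turns (7.1.19b) into the standard Hermitian product (`formV_eq_inner`). -/

section Decomposition

open scoped InnerProductSpace

/-- The curl B ↦ ∂B of (7.1.19a) as a ℂ-linear map on momentum-p one-forms. [cite: BalabanImbrieJaffe1985, (7.1.19a) p.323] -/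
def curlLin (d1 : Fin d → ℂ) : (Fin d → ℂ) →ₗ[ℂ] (Fin d → Fin d → ℂ) where
  toFun := curlP d1
  map_add' B B' := by funext μ ν; simp only [curlP, Pi.add_apply]; ring
  map_smul' c B := by funext μ ν; simp only [curlP, Pi.smul_apply, smul_eq_mul, RingHom.id_apply]; ring

/-- The rescaling f_{μν} ↦ f_{μν}/|v_μv_ν| into the standard Hermitian space ℂ^{d×d}, which turns the product (7.1.19b) into the
standard one (`formV_eq_inner`). [cite: BalabanImbrieJaffe1985, (7.1.19b) p.323] -/
def scaleLin (v : Fin d → ℂ) : (Fin d → Fin d → ℂ) →ₗ[ℂ] EuclideanSpace ℂ (Fin d × Fin d) where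
  toFun f := WithLp.toLp 2 fun i => f i.1 i.2 / (‖v i.1 * v i.2‖ : ℂ)
  map_add' f g := by
    rw [← WithLp.toLp_add]
    congr 1
    funext i
    simp only [Pi.add_apply]
    ring
  map_smul' c f := by
    rw [RingHom.id_apply, ← WithLp.toLp_smul]
    congr 1
    funext i
    simp only [Pi.smul_apply, smul_eq_mul]
    ring

/-- **(7.1.19b)** is the standard Hermitian product after the rescaling: (f, g) = ⟪S f, S g⟫.
[cite: BalabanImbrieJaffe1985, (7.1.19b) p.323] -/
theorem formV_eq_inner (v : Fin d → ℂ) (f g : Fin d → Fin d → ℂ) :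
    formV v f g = ⟪scaleLin v f, scaleLin v g⟫_ℂ := by
  rw [scaleLin, LinearMap.coe_mk, AddHom.coe_mk, EuclideanSpace.inner_toLp_toLp, dotProduct, Fintype.sum_prod_type, formV]
  refine Finset.sum_congr rfl fun μ _ => Finset.sum_congr rfl fun ν _ => ?_
  rw [Pi.star_apply, Complex.star_def, map_div₀, Complex.conj_ofReal]
  push_cast
  ring

/-- **(7.1.19a)** p. 323 [PDF 25], verbatim: *"Let ℋ(p) denote the space of momentum p lattice one-forms B. Write the two-forms
𝒦(p) as a sum of curls and an orthogonal complement, 𝒦(p) = ∂ℋ(p) + (∂ℋ(p))^⊥. (7.1.19a) … and the decomposition (7.1.19) is with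
respect to this inner product."* — EXISTENCE, PROVED: for any eigenvalue data v (no hypothesis is needed: where a weight
|v_μv_ν|^{−2} of the typed (7.1.19b) degenerates, orthogonality is only easier), every f is ∂B + f^⊥ with (∂B′, f^⊥) = 0 for all
one-forms B′. [cite: BalabanImbrieJaffe1985, (7.1.19a) p.323] -/
theorem exists_decomp719 (d1 v : Fin d → ℂ) (f : Fin d → Fin d → ℂ) :
    ∃ (B : Fin d → ℂ) (g : Fin d → Fin d → ℂ), f = curlP d1 B + g ∧ PerpCurl d1 v g := by
  let S := scaleLin v
  let K : Submodule ℂ (EuclideanSpace ℂ (Fin d × Fin d)) := LinearMap.range (S.comp (curlLin d1))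
  haveI : CompleteSpace K := FiniteDimensional.complete ℂ K
  obtain ⟨y, hy, z, hz, hsum⟩ := K.exists_add_mem_mem_orthogonal (S f)
  obtain ⟨B, hB⟩ := LinearMap.mem_range.mp hy
  refine ⟨B, f - curlP d1 B, by abel, fun B' => ?_⟩
  -- z = S (f − ∂B)
  have hz' : S (f - curlP d1 B) = z := by
    have : S (curlP d1 B) = y := hB
    rw [map_sub, this, hsum, add_sub_cancel_left]
  -- (∂B′, f − ∂B) = ⟪S ∂B′, z⟫ = 0 since S ∂B′ ∈ K and z ∈ Kᗮ
  rw [formV_eq_inner, show scaleLin v = S from rfl, hz']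
  exact (Submodule.mem_orthogonal K z).mp hz _ (LinearMap.mem_range.mpr ⟨B', rfl⟩)

/-- A curl is a two-form (antisymmetric). [cite: BalabanImbrieJaffe1985, (7.1.19a) p.323] -/
theorem isTwoForm_curlP (d1 B : Fin d → ℂ) : IsTwoForm (curlP d1 B) := by
  intro μ ν
  simp only [curlP]
  ring

/-- **(7.1.19a)** for two-forms: if f ∈ 𝒦(p) is antisymmetric then so is its component f^⊥ (and ∂B always is), so the
decomposition takes place inside 𝒦(p). [cite: BalabanImbrieJaffe1985, (7.1.19a) p.323] -/
theorem exists_decomp719_twoForm (d1 v : Fin d → ℂ) {f : Fin d → Fin d → ℂ} (hf : IsTwoForm f) :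
    ∃ (B : Fin d → ℂ) (g : Fin d → Fin d → ℂ), f = curlP d1 B + g ∧ PerpCurl d1 v g ∧ IsTwoForm g := by
  obtain ⟨B, g, hfg, hg⟩ := exists_decomp719 d1 v f
  refine ⟨B, g, hfg, hg, fun μ ν => ?_⟩
  have h1 : g = f - curlP d1 B := by rw [hfg]; abel
  rw [h1, Pi.sub_apply, Pi.sub_apply, Pi.sub_apply, Pi.sub_apply, hf μ ν, isTwoForm_curlP d1 B μ ν]
  ring

/-- The product (7.1.19b) is DEFINITE when no eigenvalue v_μ(p) vanishes: (h, h) = 0 forces h = 0.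
[cite: BalabanImbrieJaffe1985, (7.1.19b) p.323] -/
theorem eq_zero_of_formV_self_eq_zero {v : Fin d → ℂ} (hv : ∀ μ, v μ ≠ 0) {h : Fin d → Fin d → ℂ}
    (h0 : formV v h h = 0) : h = 0 := by
  rw [formV_eq_inner, inner_self_eq_zero] at h0
  have h1 : (fun i : Fin d × Fin d => h i.1 i.2 / (‖v i.1 * v i.2‖ : ℂ)) = 0 := by
    have h2 := congrArg WithLp.ofLp h0
    simpa [scaleLin] using h2
  funext μ ν
  have h3 := congrFun h1 (μ, ν)
  simp only [Pi.zero_apply, div_eq_zero_iff, Complex.ofReal_eq_zero, norm_eq_zero, mul_eq_zero] at h3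
  rcases h3 with h3 | h3 | h3
  · exact h3
  · exact absurd h3 (hv μ)
  · exact absurd h3 (hv ν)

/-- **(7.1.19a)**, UNIQUENESS: when no v_μ(p) vanishes the decomposition f = ∂B + f^⊥ is unique (𝒦(p) = ∂ℋ(p) ⊕ (∂ℋ(p))^⊥ is a
direct sum) — both the curl part and the orthogonal part are determined by f. [cite: BalabanImbrieJaffe1985, (7.1.19a) p.323] -/
theorem decomp719_unique (d1 : Fin d → ℂ) {v : Fin d → ℂ} (hv : ∀ μ, v μ ≠ 0) {B B' : Fin d → ℂ}
    {g g' : Fin d → Fin d → ℂ} (h : curlP d1 B + g = curlP d1 B' + g') (hg : PerpCurl d1 v g)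
    (hg' : PerpCurl d1 v g') : curlP d1 B = curlP d1 B' ∧ g = g' := by
  -- ∂(B − B′) = g′ − g is a curl orthogonal to itself
  have hk : curlP d1 (B - B') = g' - g := by
    rw [show curlP d1 (B - B') = curlP d1 B - curlP d1 B' from map_sub (curlLin d1) B B']
    exact sub_eq_sub_iff_add_eq_add.mpr (h.trans (add_comm _ _))
  have h0 : formV v (curlP d1 (B - B')) (curlP d1 (B - B')) = 0 := by
    nth_rewrite 2 [hk]
    rw [formV_eq_inner, map_sub, inner_sub_right, ← formV_eq_inner, ← formV_eq_inner, hg' (B - B'), hg (B - B'),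
      sub_zero]
  have hz : curlP d1 (B - B') = 0 := eq_zero_of_formV_self_eq_zero hv h0
  have hgg : g = g' := by
    rw [hz] at hk
    exact (sub_eq_zero.mp hk.symm).symm
  refine ⟨?_, hgg⟩
  have h2 : curlP d1 B - curlP d1 B' = 0 := by
    rw [← show curlP d1 (B - B') = curlP d1 B - curlP d1 B' from map_sub (curlLin d1) B B']
    exact hz
  exact sub_eq_zero.mp h2

end Decomposition
end

end Literature.MathematicalPhysics.QuantumFieldTheory.BalabanImbrieJaffe1984to88.BIJ85CurlComplement719
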